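import Literature.NumberTheory.ConnesConsani2024.ProlateWaveCyclicPairs
import Mathlib.MeasureTheory.Measure.CharacteristicFunction.Basic
import Mathlib.Analysis.SpecialFunctions.Complex.LogBounds

/-!
# Connes–Consani–Moscovici 2024, §2: the canonical form of a cyclic pair — Theorem 2.1 (ii), (iii) and Proposition 2.1 PROVED

RH-FREE corpus literature (abstract Hilbert-space operator theory: cyclic pairs `(D, ξ)` in canonical
form `H ≅ L²(ℝ, dμ)`, `D ↦` multiplication by `s`, `ξ ↦ 1`).  bears_on: W-C/W-P (sequel, no leaf role).
WHAT THIS IS NOT: any claim about RH, about `ζ`, about positivity or about any route; nothing in this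
file bears on the truth of RH.  Theorems-only companion (cell rh-crit, seat cc-t14 g2) of
`Literature.NumberTheory.ConnesConsani2024.ProlateWaveCyclicPairs` (seat cc-t12), DISCHARGING three of
its named facts:

* `CCM2024_thm_2_1_ii_holds`  — Thm. 2.1 (ii): under `U`, `E_n` becomes the polynomials of degree `≤ n`;
* `CCM2024_thm_2_1_iii_holds` — Thm. 2.1 (iii): the spectral measure is a complete invariant;
* `CCM2024_prop_2_1_holds`    — Prop. 2.1 (remaining clause): even `⟺` `μ` invariant under `s ↦ −s`.

Source: A. Connes, C. Consani, H. Moscovici, *Zeta zeros and prolate wave operators*, Ann. Funct.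
Anal. 15 (2024) 87, arXiv:2310.18423v2, §2 p. 6 [cite: ConnesConsaniMoscovici2024].  Locators
`pNNNN:Lnn` = chunk:line of the held text `paper:arxiv-2310.18423`.

## Design: no spectral theorem is needed

As TYPED, all three facts quantify over a GIVEN canonical form `(μ, U)` (hypothesis
`IsCanonicalForm D ξ μ U`); only Thm. 2.1 (i) (EXISTENCE of the canonical form, i.e. the spectral
theorem for an unbounded self-adjoint operator with a cyclic vector) needs the spectral theorem, and it
is NOT discharged here (it stays the named fact `CCM2024_thm_2_1_i`).  The printed proofs of
Thm. 2.1 (iii) and of Prop. 2.1 `⟹` use the Borel functional calculus `∫ h dμ = ⟨h(D)ξ | ξ⟩`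
(p0006:L11, L27–L31), which Mathlib lacks for unbounded operators.  It is replaced by the following
elementary mechanism (`measure_eq_of_intertwining`): a linear isometry `V : L²(μ₁) → L²(μ₂)` with
`V 1 = 1` intertwining multiplication by `s` (with domains) intertwines the bounded resolvent
multipliers `(a s + 1)⁻¹` (`a ∈ iℝ`) and their powers — pure algebra on `L²` classes
(`intertwines_affine`, `intertwines_inv`, `intertwines_mul`, `intertwines_pow`); hence
`∫ (1 − its/n)⁻ⁿ dμ₁ = ∫ (1 − its/n)⁻ⁿ dμ₂` (`integral_eq_of_intertwines`, inner products with `1`);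
dominated convergence (`|(1 − its/n)⁻ⁿ| ≤ 1`, limit `e^{its}`, Mathlib
`Complex.tendsto_one_add_div_pow_exp`) identifies the characteristic functions and Lévy's theorem
(`MeasureTheory.Measure.ext_of_charFun`) the measures.  Prop. 2.1 `⟸` follows the printed proof
verbatim (`γ(f)(s) := f(−s)` on `L²(ℝ, dμ)`, Mathlib `Lp.compMeasurePreservingₗᵢ`, transported by `U`);
Prop. 2.1 `⟹` transports the grading to `L²(μ)`, composes it with the reflection isometry
`L²(μ) → L²(μ ∘ (−))` and applies the same lemma (the grading anticommutes with `D`, so the composite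
intertwines multiplication by `s`).  Thm. 2.1 (ii): `U(Dʲξ) = sʲ` by induction on
`IsCanonicalForm.map_apply`, and the image of a span under the unitary is the span of the images.

No definitions, no new named facts (D-0026); net debt −3.

## References

* A. Connes, C. Consani, H. Moscovici, *Zeta zeros and prolate wave operators*, Ann. Funct. Anal. 15
  (2024), arXiv:2310.18423. [ConnesConsaniMoscovici2024]
-/

noncomputable section

open _root_.MeasureTheory Complex Filter
open scoped InnerProductSpace ComplexConjugate ENNReal Topology

namespace Literature.NumberTheory.ConnesConsani2024

/-! ## Intertwining calculus for multiplication operators on `L²` -/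

section Calculus

variable {μ₁ μ₂ : Measure ℝ} (V : Lp ℂ 2 μ₁ →ₗᵢ[ℂ] Lp ℂ 2 μ₂)

/-- Multiplication by a bounded measurable function preserves `L²` (plumbing). [folklore] -/
private theorem memLp_boundedMul {μ : Measure ℝ} {h : ℝ → ℂ} (hm : Measurable h) {C : ℝ}
    (hC : ∀ s, ‖h s‖ ≤ C) (φ : Lp ℂ 2 μ) :
    MemLp (fun s => h s * (φ : ℝ → ℂ) s) 2 μ := by
  refine (Lp.memLp φ).of_le_mul (c := C)
    (hm.aestronglyMeasurable.mul (Lp.memLp φ).aestronglyMeasurable) ?_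
  exact Eventually.of_forall fun s => by
    rw [norm_mul]; exact mul_le_mul_of_nonneg_right (hC s) (norm_nonneg _)

/-- If a linear isometry `V : L²(μ₁) → L²(μ₂)` intertwines the multiplication operators by the variable
`s` (relationally, on `L²` classes, domains included), it intertwines multiplication by `a s + b`. [folklore] -/
private theorem intertwines_affine
    (hV : ∀ φ ψ : Lp ℂ 2 μ₁, ((ψ : ℝ → ℂ) =ᵐ[μ₁] fun s => (s : ℂ) * (φ : ℝ → ℂ) s) →
      ((V ψ : ℝ → ℂ) =ᵐ[μ₂] fun s => (s : ℂ) * (V φ : ℝ → ℂ) s))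
    (a b : ℂ) (φ ψ : Lp ℂ 2 μ₁)
    (hψ : (ψ : ℝ → ℂ) =ᵐ[μ₁] fun s => (a * s + b) * (φ : ℝ → ℂ) s) :
    (V ψ : ℝ → ℂ) =ᵐ[μ₂] fun s => (a * s + b) * (V φ : ℝ → ℂ) s := by
  by_cases ha : a = 0
  · subst ha
    have hψ' : ψ = b • φ := by
      apply Lp.ext
      filter_upwards [hψ, Lp.coeFn_smul b φ] with s hs hs'
      rw [hs, hs', Pi.smul_apply, smul_eq_mul, zero_mul, zero_add]
    rw [hψ', map_smul]
    filter_upwards [Lp.coeFn_smul b (V φ)] with s hs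
    rw [hs, Pi.smul_apply, smul_eq_mul, zero_mul, zero_add]
  · obtain ⟨χ, hχ⟩ : ∃ χ : Lp ℂ 2 μ₁, χ = a⁻¹ • (ψ - b • φ) := ⟨_, rfl⟩
    have hχ' : (χ : ℝ → ℂ) =ᵐ[μ₁] fun s => (s : ℂ) * (φ : ℝ → ℂ) s := by
      rw [hχ]
      filter_upwards [Lp.coeFn_smul a⁻¹ (ψ - b • φ), Lp.coeFn_sub ψ (b • φ), Lp.coeFn_smul b φ,
        hψ] with s h1 h2 h3 h4
      rw [h1, Pi.smul_apply, h2, Pi.sub_apply, h3, Pi.smul_apply, h4, smul_eq_mul, smul_eq_mul]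
      field_simp
      ring
    have hVχ := hV φ χ hχ'
    have hψeq : ψ = a • χ + b • φ := by
      rw [hχ, smul_smul, mul_inv_cancel₀ ha, one_smul, sub_add_cancel]
    rw [hψeq, map_add, map_smul, map_smul]
    filter_upwards [Lp.coeFn_add (a • V χ) (b • V φ), Lp.coeFn_smul a (V χ),
      Lp.coeFn_smul b (V φ), hVχ] with s h1 h2 h3 h4
    rw [h1, Pi.add_apply, h2, h3, Pi.smul_apply, Pi.smul_apply, h4, smul_eq_mul, smul_eq_mul]
    ring

/-- If `V` intertwines multiplication by a nonvanishing `g`, it intertwines multiplication by `g⁻¹`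
(the resolvent step; no boundedness needed). [folklore] -/
private theorem intertwines_inv {g : ℝ → ℂ} (hg : ∀ s, g s ≠ 0)
    (hV : ∀ φ ψ : Lp ℂ 2 μ₁, ((ψ : ℝ → ℂ) =ᵐ[μ₁] fun s => g s * (φ : ℝ → ℂ) s) →
      ((V ψ : ℝ → ℂ) =ᵐ[μ₂] fun s => g s * (V φ : ℝ → ℂ) s))
    (φ ψ : Lp ℂ 2 μ₁) (hψ : (ψ : ℝ → ℂ) =ᵐ[μ₁] fun s => (g s)⁻¹ * (φ : ℝ → ℂ) s) :
    (V ψ : ℝ → ℂ) =ᵐ[μ₂] fun s => (g s)⁻¹ * (V φ : ℝ → ℂ) s := by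
  have hφ : (φ : ℝ → ℂ) =ᵐ[μ₁] fun s => g s * (ψ : ℝ → ℂ) s := by
    filter_upwards [hψ] with s hs
    rw [hs, ← mul_assoc, mul_inv_cancel₀ (hg s), one_mul]
  filter_upwards [hV ψ φ hφ] with s hs
  rw [hs, ← mul_assoc, inv_mul_cancel₀ (hg s), one_mul]

/-- Products: if `V` intertwines multiplication by `g` and by the bounded measurable `h`, it intertwines
multiplication by `g·h`. [folklore] -/
private theorem intertwines_mul {g h : ℝ → ℂ} (hm : Measurable h) {C : ℝ} (hC : ∀ s, ‖h s‖ ≤ C)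
    (hVg : ∀ φ ψ : Lp ℂ 2 μ₁, ((ψ : ℝ → ℂ) =ᵐ[μ₁] fun s => g s * (φ : ℝ → ℂ) s) →
      ((V ψ : ℝ → ℂ) =ᵐ[μ₂] fun s => g s * (V φ : ℝ → ℂ) s))
    (hVh : ∀ φ ψ : Lp ℂ 2 μ₁, ((ψ : ℝ → ℂ) =ᵐ[μ₁] fun s => h s * (φ : ℝ → ℂ) s) →
      ((V ψ : ℝ → ℂ) =ᵐ[μ₂] fun s => h s * (V φ : ℝ → ℂ) s))
    (φ ψ : Lp ℂ 2 μ₁) (hψ : (ψ : ℝ → ℂ) =ᵐ[μ₁] fun s => (g s * h s) * (φ : ℝ → ℂ) s) :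
    (V ψ : ℝ → ℂ) =ᵐ[μ₂] fun s => (g s * h s) * (V φ : ℝ → ℂ) s := by
  set χ : Lp ℂ 2 μ₁ := (memLp_boundedMul hm hC φ).toLp _ with hχdef
  have hχ : (χ : ℝ → ℂ) =ᵐ[μ₁] fun s => h s * (φ : ℝ → ℂ) s := MemLp.coeFn_toLp _
  have h1 : (ψ : ℝ → ℂ) =ᵐ[μ₁] fun s => g s * (χ : ℝ → ℂ) s := by
    filter_upwards [hψ, hχ] with s hs hs'
    rw [hs, hs', mul_assoc]
  filter_upwards [hVg χ ψ h1, hVh φ χ hχ] with s hs hs'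
  rw [hs, hs', mul_assoc]

/-- Powers of a bounded measurable multiplier intertwined by `V` are intertwined by `V`. [folklore] -/
private theorem intertwines_pow {h : ℝ → ℂ} (hm : Measurable h) {C : ℝ} (hC : ∀ s, ‖h s‖ ≤ C)
    (hVh : ∀ φ ψ : Lp ℂ 2 μ₁, ((ψ : ℝ → ℂ) =ᵐ[μ₁] fun s => h s * (φ : ℝ → ℂ) s) →
      ((V ψ : ℝ → ℂ) =ᵐ[μ₂] fun s => h s * (V φ : ℝ → ℂ) s))
    (n : ℕ) (φ ψ : Lp ℂ 2 μ₁) (hψ : (ψ : ℝ → ℂ) =ᵐ[μ₁] fun s => h s ^ n * (φ : ℝ → ℂ) s) :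
    (V ψ : ℝ → ℂ) =ᵐ[μ₂] fun s => h s ^ n * (V φ : ℝ → ℂ) s := by
  induction n generalizing φ ψ with
  | zero =>
    have hψ' : ψ = φ := by
      apply Lp.ext
      filter_upwards [hψ] with s hs
      rw [hs, pow_zero, one_mul]
    subst hψ'
    exact Eventually.of_forall fun s => by simp only [pow_zero, one_mul]
  | succ n ih =>
    have hψ' : (ψ : ℝ → ℂ) =ᵐ[μ₁] fun s => (h s ^ n * h s) * (φ : ℝ → ℂ) s := by
      simpa only [pow_succ] using hψ
    have := intertwines_mul V hm hC ih hVh φ ψ hψ'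
    simpa only [pow_succ] using this

/-- A bounded measurable multiplier `g` intertwined by a linear isometry `V` with `V 1 = 1` has equal
integrals: `∫ g dμ₁ = ⟨1 | g·1⟩ = ⟨V1 | V(g·1)⟩ = ⟨1 | g·1⟩ = ∫ g dμ₂`. [folklore] -/
private theorem integral_eq_of_intertwines [IsFiniteMeasure μ₁] [IsFiniteMeasure μ₂]
    {g : ℝ → ℂ} (hm : Measurable g) {C : ℝ} (hC : ∀ s, ‖g s‖ ≤ C)
    (hVg : ∀ φ ψ : Lp ℂ 2 μ₁, ((ψ : ℝ → ℂ) =ᵐ[μ₁] fun s => g s * (φ : ℝ → ℂ) s) →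
      ((V ψ : ℝ → ℂ) =ᵐ[μ₂] fun s => g s * (V φ : ℝ → ℂ) s))
    (one₁ : Lp ℂ 2 μ₁) (hone₁ : (one₁ : ℝ → ℂ) =ᵐ[μ₁] fun _ => 1)
    (hV1 : (V one₁ : ℝ → ℂ) =ᵐ[μ₂] fun _ => 1) :
    ∫ s, g s ∂μ₁ = ∫ s, g s ∂μ₂ := by
  have hgmem : MemLp g 2 μ₁ := MemLp.of_bound hm.aestronglyMeasurable C (Eventually.of_forall hC)
  set ψ : Lp ℂ 2 μ₁ := hgmem.toLp g with hψdef
  have hψ : (ψ : ℝ → ℂ) =ᵐ[μ₁] g := MemLp.coeFn_toLp _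
  have hψ' : (ψ : ℝ → ℂ) =ᵐ[μ₁] fun s => g s * (one₁ : ℝ → ℂ) s := by
    filter_upwards [hψ, hone₁] with s hs hs'
    rw [hs, hs', mul_one]
  have hVψ := hVg one₁ ψ hψ'
  have hinner : ⟪V one₁, V ψ⟫_ℂ = ⟪one₁, ψ⟫_ℂ := V.inner_map_map one₁ ψ
  rw [L2.inner_def, L2.inner_def] at hinner
  have h1 : ∫ a, ⟪(one₁ : ℝ → ℂ) a, (ψ : ℝ → ℂ) a⟫_ℂ ∂μ₁ = ∫ s, g s ∂μ₁ := by
    apply integral_congr_ae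
    filter_upwards [hone₁, hψ] with s hs hs'
    rw [hs, hs', RCLike.inner_apply', map_one, one_mul]
  have h2 : ∫ a, ⟪(V one₁ : ℝ → ℂ) a, (V ψ : ℝ → ℂ) a⟫_ℂ ∂μ₂ = ∫ s, g s ∂μ₂ := by
    apply integral_congr_ae
    filter_upwards [hV1, hVψ] with s hs hs'
    rw [hs, hs', RCLike.inner_apply', map_one, one_mul, hs, mul_one]
  rw [← h1, ← h2, hinner]

/-- The resolvent multipliers `s ↦ (a s + 1)⁻¹` with `a = −it/n ∈ iℝ`: the real part of `a s + 1` is `1`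
(so the multiplier is bounded by `1` and nonvanishing). [folklore] -/
private theorem re_affine_eq_one (t : ℝ) (n : ℕ) (s : ℝ) :
    ((-((t : ℂ) * I) / (n : ℂ)) * (s : ℂ) + 1).re = 1 := by
  have : (-((t : ℂ) * I) / (n : ℂ)) * (s : ℂ) = ((-(t * s) / n : ℝ) : ℂ) * I := by
    push_cast
    ring
  rw [this]
  simp

/-- **Core lemma** (the analytic input of Thm. 2.1 (iii) ⟹ and Prop. 2.1 ⟹, replacing the Borel
functional calculus of the printed proof): a linear isometry `V : L²(μ₁) → L²(μ₂)` between the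
`L²`-spaces of two probability measures on `ℝ` which maps the constant `1` to the constant `1` and
intertwines the (unbounded) multiplication operators by the variable `s` forces `μ₁ = μ₂`.
Mechanism: `V` intertwines the bounded multipliers `((1 − its/n))⁻ⁿ` (resolvent powers), whose integrals
therefore agree; dominated convergence (`|(1 − its/n)⁻ⁿ| ≤ 1`, limit `e^{its}`) identifies the
characteristic functions, and Lévy's uniqueness theorem (`Measure.ext_of_charFun`) the measures.
[cite: ConnesConsaniMoscovici2024, Thm. 2.1 (iii) p. 6 (p0006:L11)] -/
theorem measure_eq_of_intertwining [IsProbabilityMeasure μ₁] [IsProbabilityMeasure μ₂]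
    (hV : ∀ φ ψ : Lp ℂ 2 μ₁, ((ψ : ℝ → ℂ) =ᵐ[μ₁] fun s => (s : ℂ) * (φ : ℝ → ℂ) s) →
      ((V ψ : ℝ → ℂ) =ᵐ[μ₂] fun s => (s : ℂ) * (V φ : ℝ → ℂ) s))
    (one₁ : Lp ℂ 2 μ₁) (hone₁ : (one₁ : ℝ → ℂ) =ᵐ[μ₁] fun _ => 1)
    (hV1 : (V one₁ : ℝ → ℂ) =ᵐ[μ₂] fun _ => 1) : μ₁ = μ₂ := by
  apply Measure.ext_of_charFun
  funext t
  obtain ⟨a, ha⟩ : ∃ a : ℕ → ℂ, a = fun n : ℕ => -((t : ℂ) * I) / (n : ℂ) := ⟨_, rfl⟩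
  obtain ⟨G, hG⟩ : ∃ G : ℕ → ℝ → ℂ, G = fun (n : ℕ) (s : ℝ) => (a n * (s : ℂ) + 1)⁻¹ := ⟨_, rfl⟩
  have hre : ∀ (n : ℕ) (s : ℝ), (a n * (s : ℂ) + 1).re = 1 := fun n s => by
    rw [ha]; exact re_affine_eq_one t n s
  have hne : ∀ (n : ℕ) (s : ℝ), a n * (s : ℂ) + 1 ≠ 0 := by
    intro n s h
    have h1 := hre n s
    rw [h, zero_re] at h1
    exact zero_ne_one h1
  have hGc : ∀ n, Continuous (G n) := by
    intro n
    rw [hG]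
    exact ((continuous_const.mul continuous_ofReal).add continuous_const).inv₀ (hne n)
  have hGb : ∀ (n : ℕ) (s : ℝ), ‖G n s‖ ≤ 1 := by
    intro n s
    rw [hG]
    dsimp only
    rw [norm_inv]
    apply inv_le_one_of_one_le₀
    calc (1 : ℝ) = |(a n * (s : ℂ) + 1).re| := by rw [hre, abs_one]
      _ ≤ ‖a n * (s : ℂ) + 1‖ := abs_re_le_norm _
  -- `V` intertwines the resolvent multipliers `G n` and their powers
  have hIG : ∀ n (φ ψ : Lp ℂ 2 μ₁), ((ψ : ℝ → ℂ) =ᵐ[μ₁] fun s => G n s * (φ : ℝ → ℂ) s) →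
      ((V ψ : ℝ → ℂ) =ᵐ[μ₂] fun s => G n s * (V φ : ℝ → ℂ) s) := by
    intro n
    rw [hG]
    exact intertwines_inv V (hne n) (intertwines_affine V hV (a n) 1)
  have hIF : ∀ n (φ ψ : Lp ℂ 2 μ₁), ((ψ : ℝ → ℂ) =ᵐ[μ₁] fun s => G n s ^ n * (φ : ℝ → ℂ) s) →
      ((V ψ : ℝ → ℂ) =ᵐ[μ₂] fun s => G n s ^ n * (V φ : ℝ → ℂ) s) := fun n =>
    intertwines_pow V (hGc n).measurable (hGb n) (hIG n) n
  -- hence equal integrals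
  have hI : ∀ n, ∫ s, G n s ^ n ∂μ₁ = ∫ s, G n s ^ n ∂μ₂ := fun n =>
    integral_eq_of_intertwines V ((hGc n).pow n).measurable (C := 1)
      (fun s => by rw [norm_pow]; exact pow_le_one₀ (norm_nonneg _) (hGb n s)) (hIF n)
      one₁ hone₁ hV1
  -- pointwise limit `e^{its}`
  have hlim : ∀ s : ℝ, Tendsto (fun n => G n s ^ n) atTop (𝓝 (exp (t * s * I))) := by
    intro s
    have h1 := (Complex.tendsto_one_add_div_pow_exp (-((t : ℂ) * s * I))).inv₀ (exp_ne_zero _)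
    rw [← Complex.exp_neg, neg_neg] at h1
    refine h1.congr fun n => ?_
    simp only [hG, ha]
    rw [← inv_pow]
    congr 2
    ring
  -- dominated convergence on both sides
  have hD : ∀ μ : Measure ℝ, IsProbabilityMeasure μ →
      Tendsto (fun n => ∫ s, G n s ^ n ∂μ) atTop (𝓝 (charFun μ t)) := by
    intro μ _
    rw [charFun_apply_real]
    refine tendsto_integral_of_dominated_convergence (fun _ => (1 : ℝ))
      (fun n => ((hGc n).pow n).aestronglyMeasurable) (integrable_const 1)
      (fun n => Eventually.of_forall fun s => ?_) (Eventually.of_forall fun s => hlim s)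
    rw [norm_pow]
    exact pow_le_one₀ (norm_nonneg _) (hGb n s)
  have h1 := hD μ₁ inferInstance
  have h2 := hD μ₂ inferInstance
  simp_rw [hI] at h1
  exact tendsto_nhds_unique h1 h2

end Calculus

/-! ## Theorem 2.1 (iii): the spectral measure is a complete invariant -/

section Invariant

open InnerProductSpace

/-- RH-FREE. **Theorem 2.1 (iii)** DISCHARGED: two cyclic pairs in canonical form are unitarily
equivalent (unitary carrying `ξ₁ ↦ ξ₂` and `D₁` onto `D₂`, domains included) iff their spectral
measures coincide.  `⟹`: transport the unitary to `V = U₂ W U₁⁻¹ : L²(μ₁) → L²(μ₂)`, which maps `1 ↦ 1`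
and intertwines multiplication by `s`; conclude by `measure_eq_of_intertwining`.  `⟸`: `W = U₂⁻¹ U₁`.
[cite: ConnesConsaniMoscovici2024, Thm. 2.1 (iii) p. 6 (p0006:L11)] -/
theorem CCM2024_thm_2_1_iii_holds : CCM2024_thm_2_1_iii := by
  intro H₁ _ _ _ H₂ _ _ _ D₁ ξ₁ D₂ ξ₂ μ₁ U₁ μ₂ U₂ hD₁ hD₂ h₁ h₂
  haveI := h₁.isProbabilityMeasure
  haveI := h₂.isProbabilityMeasure
  constructor
  · rintro ⟨W, hWξ, hWdom, hWD⟩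
    obtain ⟨V, hV⟩ : ∃ V : Lp ℂ 2 μ₁ ≃ₗᵢ[ℂ] Lp ℂ 2 μ₂, V = U₁.symm.trans (W.trans U₂) := ⟨_, rfl⟩
    have hVapp : ∀ φ : Lp ℂ 2 μ₁, V φ = U₂ (W (U₁.symm φ)) := fun φ => by rw [hV]; rfl
    refine measure_eq_of_intertwining V.toLinearIsometry ?_ (U₁ ξ₁) h₁.map_vec ?_
    · intro φ ψ hψ
      have hx : U₁.symm φ ∈ D₁.domain := by
        rw [h₁.mem_domain_iff, U₁.apply_symm_apply]
        exact (Lp.memLp ψ).ae_eq hψ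
      have hUDx : U₁ (D₁ ⟨U₁.symm φ, hx⟩) = ψ := by
        apply Lp.ext
        have h := h₁.map_apply ⟨U₁.symm φ, hx⟩
        simp only [U₁.apply_symm_apply] at h
        exact h.trans hψ.symm
      have hWx : W (U₁.symm φ) ∈ D₂.domain := (hWdom _).mp hx
      have hVψ : V.toLinearIsometry ψ = U₂ (D₂ ⟨W (U₁.symm φ), hWx⟩) := by
        show V ψ = _
        rw [hVapp, ← hUDx, U₁.symm_apply_apply, hWD ⟨U₁.symm φ, hx⟩ hWx]
      rw [hVψ]
      have h := h₂.map_apply ⟨W (U₁.symm φ), hWx⟩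
      have hVφ : V.toLinearIsometry φ = U₂ (W (U₁.symm φ)) := hVapp φ
      rw [hVφ]
      exact h
    · show ((V (U₁ ξ₁) : Lp ℂ 2 μ₂) : ℝ → ℂ) =ᵐ[μ₂] fun _ => 1
      rw [hVapp, U₁.symm_apply_apply, hWξ]
      exact h₂.map_vec
  · intro hμ
    subst hμ
    refine ⟨U₁.trans U₂.symm, ?_, ?_, ?_⟩
    · show U₂.symm (U₁ ξ₁) = ξ₂
      rw [← U₂.symm_apply_apply ξ₂]
      congr 1
      exact Lp.ext (h₁.map_vec.trans h₂.map_vec.symm)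
    · intro x
      rw [h₁.mem_domain_iff, h₂.mem_domain_iff]
      show _ ↔ MemLp (fun s : ℝ => (s : ℂ) * ((U₂ (U₂.symm (U₁ x)) : Lp ℂ 2 μ₁) : ℝ → ℂ) s) 2 μ₁
      rw [U₂.apply_symm_apply]
    · intro x hx
      apply U₂.injective
      show U₂ (U₂.symm (U₁ (D₁ x))) = U₂ (D₂ ⟨U₂.symm (U₁ x), hx⟩)
      rw [U₂.apply_symm_apply]
      apply Lp.ext
      refine (h₁.map_apply x).trans ?_
      have h := h₂.map_apply ⟨U₂.symm (U₁ (x : H₁)), hx⟩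
      simp only [LinearIsometryEquiv.apply_symm_apply] at h
      exact h.symm

end Invariant

/-! ## Proposition 2.1: even ⟺ symmetric spectral measure -/

section Even

open InnerProductSpace

variable {H : Type*} [NormedAddCommGroup H] [InnerProductSpace ℂ H] [CompleteSpace H]

/-- The reflection `s ↦ −s` is measure preserving from `μ ∘ (−)` to `μ` (plumbing for Prop. 2.1). [folklore] -/
private theorem measurePreserving_neg_map (μ : Measure ℝ) :
    MeasurePreserving (fun s : ℝ => -s) (μ.map fun s : ℝ => -s) μ := by
  refine ⟨measurable_neg, ?_⟩
  rw [Measure.map_map measurable_neg measurable_neg]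
  have : ((fun s : ℝ => -s) ∘ fun s : ℝ => -s) = id := funext fun s => neg_neg s
  rw [this, Measure.map_id]

/-- RH-FREE. **Proposition 2.1, `⟹`** (PROVED): an even cyclic pair in canonical form has a spectral
measure invariant under `s ↦ −s`.  The grading, transported to `L²(μ)` and composed with the
reflection `L²(μ) → L²(μ ∘ (−))`, is an isometry fixing `1` and intertwining multiplication by `s`
(because `γ D = −D γ`), so `measure_eq_of_intertwining` applies.
[cite: ConnesConsaniMoscovici2024, Prop. 2.1 p. 6 (p0006:L25)] -/
theorem IsZ2Grading.map_neg_eq {D : H →ₗ.[ℂ] H} {ξ : H} {γ : H →L[ℂ] H} {μ : Measure ℝ}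
    {U : H ≃ₗᵢ[ℂ] Lp ℂ 2 μ} (hU : IsCanonicalForm D ξ μ U) (hγ : IsZ2Grading D ξ γ) :
    μ.map (fun s : ℝ => -s) = μ := by
  haveI := hU.isProbabilityMeasure
  have hmp := measurePreserving_neg_map μ
  haveI : IsProbabilityMeasure (μ.map fun s : ℝ => -s) :=
    Measure.isProbabilityMeasure_map measurable_neg.aemeasurable
  -- the grading as a linear isometry
  obtain ⟨γᵢ, hγᵢ⟩ : ∃ γᵢ : H →ₗᵢ[ℂ] H, ∀ x, γᵢ x = γ x :=
    ⟨(γ : H →ₗ[ℂ] H).isometryOfInner fun x y =>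
      ContinuousLinearMap.inner_map_map_of_mem_unitary hγ.mem_unitary x y, fun _ => rfl⟩
  -- the reflection `L²(μ) → L²(μ.map (−))`
  obtain ⟨R, hR⟩ : ∃ R : Lp ℂ 2 μ →ₗᵢ[ℂ] Lp ℂ 2 (μ.map fun s : ℝ => -s),
      ∀ g : Lp ℂ 2 μ, ((R g : Lp ℂ 2 (μ.map fun s : ℝ => -s)) : ℝ → ℂ) =ᵐ[μ.map fun s : ℝ => -s]
        (g : ℝ → ℂ) ∘ fun s : ℝ => -s :=
    ⟨Lp.compMeasurePreservingₗᵢ ℂ (fun s : ℝ => -s) hmp,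
      fun g => Lp.coeFn_compMeasurePreserving g hmp⟩
  set V : Lp ℂ 2 μ →ₗᵢ[ℂ] Lp ℂ 2 (μ.map fun s : ℝ => -s) :=
    R.comp (U.toLinearIsometry.comp (γᵢ.comp U.symm.toLinearIsometry)) with hVdef
  have hVapp : ∀ φ, V φ = R (U (γ (U.symm φ))) := fun φ => by
    rw [hVdef]; simp only [LinearIsometry.coe_comp, Function.comp_apply, hγᵢ]; rfl
  symm
  refine measure_eq_of_intertwining V ?_ (U ξ) hU.map_vec ?_
  · intro φ ψ hψ
    have hx : U.symm φ ∈ D.domain := by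
      rw [hU.mem_domain_iff, U.apply_symm_apply]
      exact (Lp.memLp ψ).ae_eq hψ
    have hUDx : U (D ⟨U.symm φ, hx⟩) = ψ := by
      apply Lp.ext
      have h := hU.map_apply ⟨U.symm φ, hx⟩
      simp only [U.apply_symm_apply] at h
      exact h.trans hψ.symm
    have hγx : γ (U.symm φ) ∈ D.domain := hγ.mapsTo_domain ⟨U.symm φ, hx⟩
    have hVψ : V ψ = -R (U (D ⟨γ (U.symm φ), hγx⟩)) := by
      rw [hVapp, ← hUDx, U.symm_apply_apply, hγ.anticomm ⟨U.symm φ, hx⟩, map_neg, map_neg]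
    rw [hVψ, hVapp φ]
    have h1 := hU.map_apply ⟨γ (U.symm φ), hγx⟩
    have h2 := hmp.quasiMeasurePreserving.ae_eq_comp h1
    filter_upwards [Lp.coeFn_neg (R (U (D ⟨γ (U.symm φ), hγx⟩))), hR (U (D ⟨γ (U.symm φ), hγx⟩)),
      h2, hR (U (γ (U.symm φ)))] with s hs1 hs2 hs3 hs4
    rw [hs1, Pi.neg_apply, hs2, hs3, hs4]
    simp only [Function.comp_apply]
    push_cast
    ring
  · rw [hVapp, U.symm_apply_apply, hγ.map_vec]
    have h2 := hmp.quasiMeasurePreserving.ae_eq_comp hU.map_vec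
    filter_upwards [hR (U ξ), h2] with s hs1 hs2
    rw [hs1, hs2]
    rfl

/-- RH-FREE. **Proposition 2.1, `⟸`** (PROVED): if the spectral measure of a cyclic pair in canonical
form is invariant under `s ↦ −s`, then `γ := U⁻¹ ∘ (φ ↦ φ(−·)) ∘ U` is a `ℤ/2`-grading.
[cite: ConnesConsaniMoscovici2024, Prop. 2.1 p. 6 (p0006:L25)] -/
theorem IsCanonicalForm.exists_isZ2Grading {D : H →ₗ.[ℂ] H} {ξ : H} {μ : Measure ℝ}
    {U : H ≃ₗᵢ[ℂ] Lp ℂ 2 μ} (hU : IsCanonicalForm D ξ μ U)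
    (hμ : μ.map (fun s : ℝ => -s) = μ) : ∃ γ : H →L[ℂ] H, IsZ2Grading D ξ γ := by
  have hmp : MeasurePreserving (fun s : ℝ => -s) μ μ := ⟨measurable_neg, hμ⟩
  obtain ⟨R, hR⟩ : ∃ R : Lp ℂ 2 μ →ₗᵢ[ℂ] Lp ℂ 2 μ,
      ∀ g : Lp ℂ 2 μ, ((R g : Lp ℂ 2 μ) : ℝ → ℂ) =ᵐ[μ] (g : ℝ → ℂ) ∘ fun s : ℝ => -s :=
    ⟨Lp.compMeasurePreservingₗᵢ ℂ (fun s : ℝ => -s) hmp,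
      fun g => Lp.coeFn_compMeasurePreserving g hmp⟩
  have hRR : ∀ g, R (R g) = g := by
    intro g
    apply Lp.ext
    have h2 := hmp.quasiMeasurePreserving.ae_eq_comp (hR g)
    filter_upwards [hR (R g), h2] with s hs1 hs2
    rw [hs1, hs2]
    simp only [Function.comp_apply, neg_neg]
  set γᵢ : H →ₗᵢ[ℂ] H := U.symm.toLinearIsometry.comp (R.comp U.toLinearIsometry) with hγᵢdef
  have hγapp : ∀ x, γᵢ x = U.symm (R (U x)) := fun x => rfl
  have hUγ : ∀ x, U (γᵢ x) = R (U x) := fun x => by rw [hγapp, U.apply_symm_apply]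
  have hγγ : ∀ x, γᵢ (γᵢ x) = x := fun x => by
    rw [hγapp, hUγ, hRR, U.symm_apply_apply]
  have hdom : ∀ x : D.domain, γᵢ (x : H) ∈ D.domain := by
    intro x
    rw [hU.mem_domain_iff, hUγ]
    have hx := (hU.mem_domain_iff (x : H)).mp x.2
    have h1 := (hx.comp_measurePreserving hmp).neg
    refine h1.ae_eq ?_
    filter_upwards [hR (U (x : H))] with s hs
    rw [hs]
    simp only [Pi.neg_apply, Function.comp_apply]
    push_cast
    ring
  refine ⟨γᵢ.toContinuousLinearMap, ⟨?_, ?_, hdom, ?_, ?_⟩⟩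
  · ext x
    exact hγγ x
  · rw [ContinuousLinearMap.isSelfAdjoint_iff_isSymmetric]
    intro x y
    show ⟪γᵢ x, y⟫_ℂ = ⟪x, γᵢ y⟫_ℂ
    rw [← hγγ y, γᵢ.inner_map_map, hγγ]
  · intro x
    show γᵢ (D x) = -D ⟨γᵢ (x : H), hdom x⟩
    apply U.injective
    rw [hUγ, map_neg]
    apply Lp.ext
    have h1 := hmp.quasiMeasurePreserving.ae_eq_comp (hU.map_apply x)
    have h2 := hU.map_apply ⟨γᵢ (x : H), hdom x⟩
    have h3 : ((U (γᵢ (x : H)) : Lp ℂ 2 μ) : ℝ → ℂ) =ᵐ[μ] ((U (x : H) : Lp ℂ 2 μ) : ℝ → ℂ) ∘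
        fun s : ℝ => -s := by rw [hUγ]; exact hR _
    filter_upwards [hR (U (D x)), h1, Lp.coeFn_neg (U (D ⟨γᵢ (x : H), hdom x⟩)), h2, h3]
      with s hs1 hs2 hs3 hs4 hs5
    rw [hs1, hs2, hs3, Pi.neg_apply, hs4]
    simp only [Function.comp_apply]
    rw [hs5]
    simp only [Function.comp_apply]
    push_cast
    ring
  · show γᵢ ξ = ξ
    rw [hγapp, ← U.symm_apply_apply ξ]
    congr 1
    rw [U.apply_symm_apply]
    apply Lp.ext
    have h1 := hmp.quasiMeasurePreserving.ae_eq_comp hU.map_vec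
    filter_upwards [hR (U ξ), h1, hU.map_vec] with s hs1 hs2 hs3
    rw [hs1, hs2, hs3]
    rfl

/-- RH-FREE. **Proposition 2.1** DISCHARGED (remaining clause of the typed fact): a cyclic pair in
canonical form is even iff its spectral measure is invariant under `s ↦ −s`.
[cite: ConnesConsaniMoscovici2024, Prop. 2.1 p. 6 (p0006:L25)] -/
theorem CCM2024_prop_2_1_holds : CCM2024_prop_2_1 := by
  intro H _ _ _ D ξ μ U hD hU
  exact ⟨fun ⟨γ, hγ⟩ => hγ.map_neg_eq hU, hU.exists_isZ2Grading⟩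

end Even

/-! ## Theorem 2.1 (ii): `U(E_n)` is the space of polynomials of degree `≤ n` -/

section Polynomials

open Polynomial

/-- RH-FREE. **Theorem 2.1 (ii)** DISCHARGED: in canonical form `U(Dʲ ξ) = sʲ`, so that `U(E_n)` is
the space of (classes of) polynomial functions of degree `≤ n` in `L²(ℝ, dμ)`.
[cite: ConnesConsaniMoscovici2024, Thm. 2.1 (ii) p. 6 (p0006:L9)] -/
theorem CCM2024_thm_2_1_ii_holds : CCM2024_thm_2_1_ii := by
  intro H _ _ _ D ξ v μ U hD hv hU n
  -- `U (Dʲ ξ) = sʲ`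
  have hpow : ∀ j : ℕ, ((U (v j : H) : Lp ℂ 2 μ) : ℝ → ℂ) =ᵐ[μ] fun s => (s : ℂ) ^ j := by
    intro j
    induction j with
    | zero =>
      rw [hv.1]
      filter_upwards [hU.map_vec] with s hs
      rw [hs, pow_zero]
    | succ j ih =>
      rw [hv.2 j]
      filter_upwards [hU.map_apply (v j), ih] with s hs hs'
      rw [hs, hs', pow_succ, mul_comm]
  -- the polynomial classes of degree `≤ n` form a submodule
  let S : Submodule ℂ (Lp ℂ 2 μ) :=
    { carrier := {g : Lp ℂ 2 μ | ∃ p : ℂ[X], p.natDegree ≤ n ∧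
        (g : ℝ → ℂ) =ᵐ[μ] fun s => p.eval (s : ℂ)}
      zero_mem' := ⟨0, by simp, by
        filter_upwards [Lp.coeFn_zero ℂ 2 μ] with s hs
        rw [hs, Pi.zero_apply, eval_zero]⟩
      add_mem' := by
        rintro g₁ g₂ ⟨p₁, hp₁, h₁⟩ ⟨p₂, hp₂, h₂⟩
        refine ⟨p₁ + p₂, (natDegree_add_le _ _).trans (max_le hp₁ hp₂), ?_⟩
        filter_upwards [Lp.coeFn_add g₁ g₂, h₁, h₂] with s hs hs₁ hs₂
        rw [hs, Pi.add_apply, hs₁, hs₂, eval_add]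
      smul_mem' := by
        rintro c g ⟨p, hp, h⟩
        refine ⟨c • p, (natDegree_smul_le _ _).trans hp, ?_⟩
        filter_upwards [Lp.coeFn_smul c g, h] with s hs hs'
        rw [hs, Pi.smul_apply, hs', eval_smul, smul_eq_mul] }
  -- the image of `E_n` is the span of the monomials
  have hL : (fun x : H => (U x : Lp ℂ 2 μ)) '' (krylovSpan v n : Set H) =
      (Submodule.span ℂ ((fun x : H => (U x : Lp ℂ 2 μ)) '' ((fun j => (v j : H)) '' Set.Iic n)) :
        Set (Lp ℂ 2 μ)) := by
    show ⇑(U.toLinearEquiv : H →ₗ[ℂ] Lp ℂ 2 μ) '' _ = (Submodule.span ℂ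
      (⇑(U.toLinearEquiv : H →ₗ[ℂ] Lp ℂ 2 μ) '' ((fun j => (v j : H)) '' Set.Iic n)) : Set (Lp ℂ 2 μ))
    rw [krylovSpan, ← Submodule.map_coe, Submodule.map_span]
  rw [hL]
  show ((Submodule.span ℂ ((fun x : H => (U x : Lp ℂ 2 μ)) '' ((fun j => (v j : H)) '' Set.Iic n)) :
    Submodule ℂ (Lp ℂ 2 μ)) : Set (Lp ℂ 2 μ)) = (S : Set (Lp ℂ 2 μ))
  congr 1
  apply le_antisymm
  · refine Submodule.span_le.mpr ?_
    rintro _ ⟨_, ⟨j, hj, rfl⟩, rfl⟩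
    refine ⟨X ^ j, (natDegree_X_pow_le j).trans (Set.mem_Iic.mp hj), ?_⟩
    filter_upwards [hpow j] with s hs
    rw [hs, eval_pow, eval_X]
  · rintro g ⟨p, hp, hg⟩
    have hsum : g = ∑ j ∈ Finset.range (n + 1), p.coeff j • (U (v j : H) : Lp ℂ 2 μ) := by
      apply Lp.ext
      refine hg.trans ?_
      have hae : ∀ᵐ s ∂μ, ∀ j ∈ Finset.range (n + 1),
          ((p.coeff j • (U (v j : H) : Lp ℂ 2 μ) : Lp ℂ 2 μ) : ℝ → ℂ) s = p.coeff j * (s : ℂ) ^ j := by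
        refine (ae_ball_iff (Finset.countable_toSet _)).mpr fun j _ => ?_
        filter_upwards [Lp.coeFn_smul (p.coeff j) (U (v j : H) : Lp ℂ 2 μ), hpow j] with s hs hs'
        rw [hs, Pi.smul_apply, hs', smul_eq_mul]
      filter_upwards [Lp.coeFn_finsetSum (Finset.range (n + 1))
        (fun j => p.coeff j • (U (v j : H) : Lp ℂ 2 μ)), hae] with s hs hs'
      rw [hs, Finset.sum_apply, eval_eq_sum_range' (Nat.lt_succ_of_le hp)]
      exact Finset.sum_congr rfl fun j hj => (hs' j hj).symm
    rw [hsum]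
    refine Submodule.sum_mem _ fun j hj => Submodule.smul_mem _ _ (Submodule.subset_span ?_)
    exact ⟨v j, ⟨j, Set.mem_Iic.mpr (Nat.lt_succ_iff.mp (Finset.mem_range.mp hj)), rfl⟩, rfl⟩

end Polynomials

end Literature.NumberTheory.ConnesConsani2024
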